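import Mathlib.LinearAlgebra.Matrix.BilinearForm
import Mathlib.LinearAlgebra.Determinant
import HarnessLib

/-!
# Gram determinants of a bilinear form transform with the determinants of the frame maps

For a bilinear form `B` on a module `V` over a commutative ring `R`, a basis `b : ι → V` (finite `ι`)
and two endomorphisms `L L' : V →ₗ[R] V`, the "mixed Gram matrix" `(B (L bᵢ) (L' bⱼ))ᵢⱼ` is
`[L]ᵀ [B] [L']` (Mathlib's `LinearMap.BilinForm.toMatrix_comp`), hence

* `det_gram_comp_eq_det_mul_det_mul` — `det (B (L bᵢ) (L' bⱼ)) = det L · det L' · det (B bᵢ bⱼ)`;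
* `det_gram_comp_eq_det_sq_mul` — the case `L' = L`: `det (B (L bᵢ) (L bⱼ)) = (det L)² · det (B bᵢ bⱼ)`.

This is the linear algebra behind the change-of-frame rule `√(det h) ↦ |det L| √(det h)` for volume
densities (`Literature/Geometry/Lorentzian/EndVolume.lean`, `…/LorentzianVolume.lean`, which specialise
these lemmas to `R = ℝ`); it is kept in a Mathlib-only leaf so that users of the rule do not import any
geometry. Elementary; no single source. [folklore]
-/

namespace Literature.LinearAlgebra.Matrix

variable {R : Type*} [CommRing R] {V : Type*} [AddCommGroup V] [Module R V]
  {ι : Type*} [Fintype ι] [DecidableEq ι]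

/-- The mixed Gram matrix `(B (L bᵢ) (L' bⱼ))ᵢⱼ` of a bilinear form `B` in a basis `b` is the matrix of
the bilinear form `B ∘ (L × L')`. [folklore] -/
theorem of_bilin_comp_eq_toMatrix (b : Module.Basis ι R V) (B : LinearMap.BilinForm R V)
    (L L' : V →ₗ[R] V) :
    (Matrix.of fun i j ↦ B (L (b i)) (L' (b j))) = LinearMap.BilinForm.toMatrix b (B.comp L L') := by
  ext i j
  rw [Matrix.of_apply, LinearMap.BilinForm.toMatrix_apply, LinearMap.BilinForm.comp_apply]

/-- The Gram matrix `(B bᵢ bⱼ)ᵢⱼ` of a bilinear form `B` in a basis `b` is `BilinForm.toMatrix b B`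
(entrywise form of `LinearMap.BilinForm.toMatrix_apply`). [folklore] -/
theorem of_bilin_eq_toMatrix (b : Module.Basis ι R V) (B : LinearMap.BilinForm R V) :
    (Matrix.of fun i j ↦ B (b i) (b j)) = LinearMap.BilinForm.toMatrix b B := by
  ext i j
  rw [Matrix.of_apply, LinearMap.BilinForm.toMatrix_apply]

/-- **Mixed Gram determinants transform with the product of the determinants**: for a bilinear
form `B` over a commutative ring, endomorphisms `L, L'` and a basis `b`,
`det (B (L bᵢ) (L' bⱼ)) = det L · det L' · det (B bᵢ bⱼ)` (from `[B ∘ (L × L')] = [L]ᵀ [B] [L']`,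
Mathlib's `LinearMap.BilinForm.toMatrix_comp`, and `det [L]ᵀ = det L`). [folklore] -/
theorem det_gram_comp_eq_det_mul_det_mul (b : Module.Basis ι R V) (B : LinearMap.BilinForm R V)
    (L L' : V →ₗ[R] V) :
    (Matrix.of fun i j ↦ B (L (b i)) (L' (b j))).det =
      LinearMap.det L * LinearMap.det L' * (Matrix.of fun i j ↦ B (b i) (b j)).det := by
  rw [of_bilin_comp_eq_toMatrix, of_bilin_eq_toMatrix, LinearMap.BilinForm.toMatrix_comp b b]
  simp only [Matrix.det_mul, Matrix.det_transpose, LinearMap.det_toMatrix]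
  ring

/-- **Gram determinants transform with the square of the determinant**: for a bilinear form `B`
over a commutative ring, an endomorphism `L` and a basis `b`,
`det (B (L bᵢ) (L bⱼ)) = (det L)² · det (B bᵢ bⱼ)`. [folklore] -/
theorem det_gram_comp_eq_det_sq_mul (b : Module.Basis ι R V) (B : LinearMap.BilinForm R V)
    (L : V →ₗ[R] V) :
    (Matrix.of fun i j ↦ B (L (b i)) (L (b j))).det =
      LinearMap.det L ^ 2 * (Matrix.of fun i j ↦ B (b i) (b j)).det := by
  rw [det_gram_comp_eq_det_mul_det_mul, sq]

end Literature.LinearAlgebra.Matrix
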